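import Mathlib
import Summits.Ventures.PercRepro2.Defs
import Summits.Ventures.PercRepro2.Independence
import Summits.Ventures.PercRepro2.Harris
import Summits.Ventures.PercRepro2.Graph
import Summits.Ventures.PercRepro2.Exploration
import Summits.Ventures.PercRepro2.Events
import Summits.Ventures.PercRepro2.FourFunctions
import Summits.Ventures.PercRepro2.Induced
import Summits.Ventures.PercRepro2.Frontier
import Summits.Ventures.PercRepro2.ObsIndependence
import Summits.Ventures.PercRepro2.BHK
import Summits.Ventures.PercRepro2.BHKEvents
import Summits.Ventures.PercRepro2.SideAgreement
import Summits.Ventures.PercRepro2.VdBKahn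
import Summits.Ventures.PercRepro2.BHKAvoid
import Summits.Ventures.PercRepro2.R2PrimeThreeReduction
import Summits.Ventures.PercRepro2.YBridge
import Summits.Ventures.PercRepro2.Yu1Functionals
import Summits.Ventures.PercRepro2.Yu1Events
import Summits.Ventures.PercRepro2.Yu1
import Summits.Ventures.PercRepro2.LBSplit
import Summits.Ventures.PercRepro2.YDelta
import Summits.Ventures.PercRepro2.SD
import Summits.Ventures.PercRepro2.Threshold
import Summits.Ventures.PercRepro2.Lambda
import Summits.Ventures.PercRepro2.LambdaTau
import Summits.Ventures.PercRepro2.LambdaSlack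
import Summits.Ventures.PercRepro2.HF2
import Summits.Ventures.PercRepro2.Yu2
import Summits.Ventures.PercRepro2.N0
import Summits.Ventures.PercRepro2.Y
import Summits.Ventures.PercRepro2.YDeltaTools
import Summits.Ventures.PercRepro2.ZDelta
import Summits.Ventures.PercRepro2.ZExpand
import Summits.Ventures.PercRepro2.ISplit
import Summits.Ventures.PercRepro2.MRl
import Summits.Ventures.PercRepro2.ZOloc
import Summits.Ventures.PercRepro2.SideBridge
import Summits.Ventures.PercRepro2.HCov

/-!
# The twelve functions of the (HCOV) cubic form and their expectations (blind cell PercRepro2,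
typer-1; p1 g6 ask 2026-08-23T05:35:24Z, `P1-TWOCOPY.md` §8 — the vocabulary half of the bridge
`hcov_cubic`, which is in `HCovCubic.lean`)

With `σ_v = 1_{v∈C₁} − 1_{v∈C₂}` (`sigma`) and `1_{v∈U} = 1_{v∈C₁} + 1_{v∈C₂}` (`inU`, exact inside `1_Q`):
`f₁ = 1_Q` (`iQ`), `f₂ = 1_PD` (`iPD`), `f₃ = 1_PD 1_{o∈U}`, `f₄ = 1_Q σ_o σ_b`, `f₅ = 1_Q σ₃ σ_b`,
`f₆ = 1_Q σ₃ 1_{o∈U} σ_b`, `f₇ = 1_Q σ_b` (`f₈ = f7` at `o`, `f₉ = f7` at `a₃`), `f₁₀ = 1_Q σ₃ 1_{o∈U}`,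
`f₁₁ = 1_PD 1_{o∈U} 1_{b∈U}`, `f₁₂ = 1_PD 1_{b∈U}`.  **`expect_f1` … `expect_f12`**: their expectations
are the pattern atoms of `HCov.lean` (`P(Q)`, `D`, `Do`, `EQbo`, `EQb3`, `EQb3o`, `−gap`, `EQo`, `EQ3`,
`EQ3o`, `PDbo`, `PDb`); `expect_ind1..4` (expectations of indicator products are probabilities of
intersections), `expect_comb8` (eight-term linearity), `T_eq_Q_inter` (`T = Q ∩ {a₃ ∈ C₂}`).
-/

namespace Summit.Ventures.PercRepro2

open UnionCluster

namespace CovForm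

/-! ## Indicator functions and the twelve functions -/

section Fns

variable {V : Type*} {E : Type*} {R : Type*} [Field R]

/-- `1_{v ∈ C₁}`. -/
noncomputable def iL (ends : E → Sym2 V) (a₁ v : V) : Config E → R := (connEvent ends a₁ v).indicator 1

/-- `1_{v ∈ C₂}`. -/
noncomputable def iH (ends : E → Sym2 V) (a₂ v : V) : Config E → R := (connEvent ends a₂ v).indicator 1

/-- `1_Q`. -/
noncomputable def iQ (ends : E → Sym2 V) (a₁ a₂ : V) : Config E → R :=
  (avoidAll ends a₂ {a₁}).indicator 1

/-- `1_PD`. -/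
noncomputable def iPD (ends : E → Sym2 V) (a₁ a₂ a₃ : V) : Config E → R :=
  (PDEvent ends a₁ a₂ a₃).indicator 1

/-- The side sign `σ_v = 1_{v∈C₁} − 1_{v∈C₂}`. -/
noncomputable def sigma (ends : E → Sym2 V) (a₁ a₂ v : V) : Config E → R :=
  fun ω => iL ends a₁ v ω - iH ends a₂ v ω

/-- `1_{v ∈ U}` in the exclusive form `1_{v∈C₁} + 1_{v∈C₂}` (exact on `Q`). -/
noncomputable def inU (ends : E → Sym2 V) (a₁ a₂ v : V) : Config E → R :=
  fun ω => iL ends a₁ v ω + iH ends a₂ v ω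

/-- `f₃ = 1_PD 1_{o∈U}`. -/
noncomputable def f3 (ends : E → Sym2 V) (o a₁ a₂ a₃ : V) : Config E → R :=
  fun ω => iPD ends a₁ a₂ a₃ ω * inU ends a₁ a₂ o ω

/-- `f₄ = 1_Q σ_o σ_b`. -/
noncomputable def f4 (ends : E → Sym2 V) (o a₁ a₂ b : V) : Config E → R :=
  fun ω => iQ ends a₁ a₂ ω * (sigma ends a₁ a₂ o ω * sigma ends a₁ a₂ b ω)

/-- `f₅ = 1_Q σ₃ σ_b`. -/
noncomputable def f5 (ends : E → Sym2 V) (a₁ a₂ a₃ b : V) : Config E → R :=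
  fun ω => iQ ends a₁ a₂ ω * (sigma ends a₁ a₂ a₃ ω * sigma ends a₁ a₂ b ω)

/-- `f₆ = 1_Q σ₃ 1_{o∈U} σ_b`. -/
noncomputable def f6 (ends : E → Sym2 V) (o a₁ a₂ a₃ b : V) : Config E → R :=
  fun ω => iQ ends a₁ a₂ ω * (sigma ends a₁ a₂ a₃ ω * (inU ends a₁ a₂ o ω * sigma ends a₁ a₂ b ω))

/-- `f₇ = 1_Q σ_b`. -/
noncomputable def f7 (ends : E → Sym2 V) (a₁ a₂ b : V) : Config E → R :=
  fun ω => iQ ends a₁ a₂ ω * sigma ends a₁ a₂ b ω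

/-- `f₁₀ = 1_Q σ₃ 1_{o∈U}`. -/
noncomputable def f10 (ends : E → Sym2 V) (o a₁ a₂ a₃ : V) : Config E → R :=
  fun ω => iQ ends a₁ a₂ ω * (sigma ends a₁ a₂ a₃ ω * inU ends a₁ a₂ o ω)

/-- `f₁₁ = 1_PD 1_{o∈U} 1_{b∈U}`. -/
noncomputable def f11 (ends : E → Sym2 V) (o a₁ a₂ a₃ b : V) : Config E → R :=
  fun ω => iPD ends a₁ a₂ a₃ ω * (inU ends a₁ a₂ o ω * inU ends a₁ a₂ b ω)

/-- `f₁₂ = 1_PD 1_{b∈U}`. -/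
noncomputable def f12 (ends : E → Sym2 V) (a₁ a₂ a₃ b : V) : Config E → R :=
  fun ω => iPD ends a₁ a₂ a₃ ω * inU ends a₁ a₂ b ω

end Fns

/-! ## Expectations of indicator products -/

section IndExpect

variable {E : Type*} [Fintype E] [DecidableEq E] {R : Type*} [Field R]

/-- `E[1_A] = P(A)`. -/
lemma expect_ind1 (p : E → R) (A : Set (Config E)) :
    expect p (fun ω => A.indicator 1 ω) = prob p A :=
  (prob_eq_expect_indicator p A).symm

/-- `E[1_A 1_B] = P(A ∩ B)`. -/
lemma expect_ind2 (p : E → R) (A B : Set (Config E)) :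
    expect p (fun ω => A.indicator 1 ω * B.indicator 1 ω) = prob p (A ∩ B) := by
  rw [prob_eq_expect_indicator]
  congr 1
  funext ω
  rw [indicator_inter_one]

/-- `E[1_A 1_B 1_C] = P(A ∩ (B ∩ C))`. -/
lemma expect_ind3 (p : E → R) (A B C : Set (Config E)) :
    expect p (fun ω => A.indicator 1 ω * (B.indicator 1 ω * C.indicator 1 ω)) =
      prob p (A ∩ (B ∩ C)) := by
  rw [prob_eq_expect_indicator]
  congr 1
  funext ω
  rw [indicator_inter_one, indicator_inter_one]

/-- `E[1_A 1_B 1_C 1_D] = P(A ∩ (B ∩ (C ∩ D)))`. -/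
lemma expect_ind4 (p : E → R) (A B C D : Set (Config E)) :
    expect p (fun ω => A.indicator 1 ω * (B.indicator 1 ω * (C.indicator 1 ω * D.indicator 1 ω))) =
      prob p (A ∩ (B ∩ (C ∩ D))) := by
  rw [prob_eq_expect_indicator]
  congr 1
  funext ω
  rw [indicator_inter_one, indicator_inter_one, indicator_inter_one]

/-- Eight-term linearity of `expect` (pointwise hypothesis). -/
lemma expect_comb8 (p : E → R) {g f₁ f₂ f₃ f₄ f₅ f₆ f₇ f₈ : Config E → R}
    {c₁ c₂ c₃ c₄ c₅ c₆ c₇ c₈ : R}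
    (h : ∀ ω, g ω = c₁ * f₁ ω + c₂ * f₂ ω + c₃ * f₃ ω + c₄ * f₄ ω + c₅ * f₅ ω + c₆ * f₆ ω +
      c₇ * f₇ ω + c₈ * f₈ ω) :
    expect p g = c₁ * expect p f₁ + c₂ * expect p f₂ + c₃ * expect p f₃ + c₄ * expect p f₄ +
      c₅ * expect p f₅ + c₆ * expect p f₆ + c₇ * expect p f₇ + c₈ * expect p f₈ := by
  simp only [expect]
  have h' : ∀ ω, weight p ω * g ω = c₁ * (weight p ω * f₁ ω) + c₂ * (weight p ω * f₂ ω) +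
      c₃ * (weight p ω * f₃ ω) + c₄ * (weight p ω * f₄ ω) + c₅ * (weight p ω * f₅ ω) +
      c₆ * (weight p ω * f₆ ω) + c₇ * (weight p ω * f₇ ω) + c₈ * (weight p ω * f₈ ω) := by
    intro ω
    rw [h ω]
    ring
  simp only [h', Finset.sum_add_distrib, ← Finset.mul_sum]

end IndExpect

/-! ## The expectations of the twelve functions -/

section Moments

variable {V : Type*} {E : Type*} [Fintype E] [DecidableEq E] [DecidableEq V] {R : Type*}
  [Field R] [LinearOrder R] [IsStrictOrderedRing R]

omit [Fintype E] [DecidableEq E] [DecidableEq V] [LinearOrder R] [IsStrictOrderedRing R] in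
/-- `T = Q ∩ {a₃ ∈ C₂}`. -/
lemma T_eq_Q_inter (ends : E → Sym2 V) (a₁ a₂ a₃ : V) :
    TEvent ends a₁ a₂ a₃ = avoidAll ends a₂ {a₁} ∩ connEvent ends a₂ a₃ := by
  ext ω
  simp only [TEvent, Set.mem_inter_iff, Set.mem_compl_iff, mem_connEvent, mem_avoidAll,
    Finset.mem_singleton, forall_eq]

omit [DecidableEq V] [LinearOrder R] [IsStrictOrderedRing R] in
/-- `E[f₁] = P(Q)`. -/
lemma expect_f1 (p : E → R) (ends : E → Sym2 V) (a₁ a₂ : V) :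
    expect p (iQ ends a₁ a₂) = prob p (avoidAll ends a₂ {a₁}) :=
  expect_ind1 p _

omit [DecidableEq V] [LinearOrder R] [IsStrictOrderedRing R] in
/-- `E[f₂] = D`. -/
lemma expect_f2 (p : E → R) (ends : E → Sym2 V) (a₁ a₂ a₃ : V) :
    expect p (iPD ends a₁ a₂ a₃) = prob p (PDEvent ends a₁ a₂ a₃) :=
  expect_ind1 p _

omit [DecidableEq V] [LinearOrder R] [IsStrictOrderedRing R] in
/-- `E[f₃] = D_o`. -/
lemma expect_f3 (p : E → R) (ends : E → Sym2 V) (o a₁ a₂ a₃ : V) :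
    expect p (f3 ends o a₁ a₂ a₃) = Do p ends o a₁ a₂ a₃ := by
  have h := Lambda.expect_comb p (g := f3 ends o a₁ a₂ a₃)
    (f₁ := fun ω => (PDEvent ends a₁ a₂ a₃).indicator 1 ω * (connEvent ends a₁ o).indicator 1 ω)
    (f₂ := fun ω => (PDEvent ends a₁ a₂ a₃).indicator 1 ω * (connEvent ends a₂ o).indicator 1 ω)
    (c₁ := 1) (c₂ := 1) (fun ω => by unfold f3 iPD inU iL iH; ring)
  rw [h, expect_ind2, expect_ind2]
  unfold Do
  ring

omit [DecidableEq V] [LinearOrder R] [IsStrictOrderedRing R] in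
/-- `E[f₄] = E_Q[σ_b σ_o]`. -/
lemma expect_f4 (p : E → R) (ends : E → Sym2 V) (o a₁ a₂ b : V) :
    expect p (f4 ends o a₁ a₂ b) = EQbo p ends o a₁ a₂ b := by
  have h := expect_comb8 p (g := f4 ends o a₁ a₂ b)
    (f₁ := fun ω => (avoidAll ends a₂ {a₁}).indicator 1 ω *
      ((connEvent ends a₁ o).indicator 1 ω * (connEvent ends a₁ b).indicator 1 ω))
    (f₂ := fun ω => (avoidAll ends a₂ {a₁}).indicator 1 ω *
      ((connEvent ends a₂ o).indicator 1 ω * (connEvent ends a₂ b).indicator 1 ω))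
    (f₃ := fun ω => (avoidAll ends a₂ {a₁}).indicator 1 ω *
      ((connEvent ends a₂ o).indicator 1 ω * (connEvent ends a₁ b).indicator 1 ω))
    (f₄ := fun ω => (avoidAll ends a₂ {a₁}).indicator 1 ω *
      ((connEvent ends a₁ o).indicator 1 ω * (connEvent ends a₂ b).indicator 1 ω))
    (f₅ := fun _ => 0) (f₆ := fun _ => 0) (f₇ := fun _ => 0) (f₈ := fun _ => 0)
    (c₁ := 1) (c₂ := 1) (c₃ := -1) (c₄ := -1) (c₅ := 0) (c₆ := 0) (c₇ := 0) (c₈ := 0)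
    (fun ω => by unfold f4 iQ sigma iL iH; ring)
  rw [h, expect_ind3, expect_ind3, expect_ind3, expect_ind3]
  unfold EQbo
  ring

omit [DecidableEq V] [LinearOrder R] [IsStrictOrderedRing R] in
/-- `E[f₅] = E_Q[σ_b σ₃]`. -/
lemma expect_f5 (p : E → R) (ends : E → Sym2 V) (a₁ a₂ a₃ b : V) :
    expect p (f5 ends a₁ a₂ a₃ b) = EQb3 p ends a₁ a₂ a₃ b := by
  have h := expect_comb8 p (g := f5 ends a₁ a₂ a₃ b)
    (f₁ := fun ω => (avoidAll ends a₂ {a₁}).indicator 1 ω *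
      ((connEvent ends a₁ a₃).indicator 1 ω * (connEvent ends a₁ b).indicator 1 ω))
    (f₂ := fun ω => (avoidAll ends a₂ {a₁}).indicator 1 ω *
      ((connEvent ends a₂ a₃).indicator 1 ω * (connEvent ends a₂ b).indicator 1 ω))
    (f₃ := fun ω => (avoidAll ends a₂ {a₁}).indicator 1 ω *
      ((connEvent ends a₂ a₃).indicator 1 ω * (connEvent ends a₁ b).indicator 1 ω))
    (f₄ := fun ω => (avoidAll ends a₂ {a₁}).indicator 1 ω *
      ((connEvent ends a₁ a₃).indicator 1 ω * (connEvent ends a₂ b).indicator 1 ω))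
    (f₅ := fun _ => 0) (f₆ := fun _ => 0) (f₇ := fun _ => 0) (f₈ := fun _ => 0)
    (c₁ := 1) (c₂ := 1) (c₃ := -1) (c₄ := -1) (c₅ := 0) (c₆ := 0) (c₇ := 0) (c₈ := 0)
    (fun ω => by unfold f5 iQ sigma iL iH; ring)
  rw [h, expect_ind3, expect_ind3, expect_ind3, expect_ind3]
  unfold EQb3
  rw [ZOloc.Tp_eq_Q_inter, T_eq_Q_inter]
  simp only [Set.inter_assoc]
  ring

omit [DecidableEq V] [LinearOrder R] [IsStrictOrderedRing R] in
/-- `E[f₆] = E_Q[σ_b σ₃ 1_{o∈U}]`. -/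
lemma expect_f6 (p : E → R) (ends : E → Sym2 V) (o a₁ a₂ a₃ b : V) :
    expect p (f6 ends o a₁ a₂ a₃ b) = EQb3o p ends o a₁ a₂ a₃ b := by
  have h := expect_comb8 p (g := f6 ends o a₁ a₂ a₃ b)
    (f₁ := fun ω => (avoidAll ends a₂ {a₁}).indicator 1 ω * ((connEvent ends a₁ a₃).indicator 1 ω *
      ((connEvent ends a₁ o).indicator 1 ω * (connEvent ends a₁ b).indicator 1 ω)))
    (f₂ := fun ω => (avoidAll ends a₂ {a₁}).indicator 1 ω * ((connEvent ends a₁ a₃).indicator 1 ω *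
      ((connEvent ends a₂ o).indicator 1 ω * (connEvent ends a₁ b).indicator 1 ω)))
    (f₃ := fun ω => (avoidAll ends a₂ {a₁}).indicator 1 ω * ((connEvent ends a₂ a₃).indicator 1 ω *
      ((connEvent ends a₁ o).indicator 1 ω * (connEvent ends a₂ b).indicator 1 ω)))
    (f₄ := fun ω => (avoidAll ends a₂ {a₁}).indicator 1 ω * ((connEvent ends a₂ a₃).indicator 1 ω *
      ((connEvent ends a₂ o).indicator 1 ω * (connEvent ends a₂ b).indicator 1 ω)))
    (f₅ := fun ω => (avoidAll ends a₂ {a₁}).indicator 1 ω * ((connEvent ends a₂ a₃).indicator 1 ω *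
      ((connEvent ends a₁ o).indicator 1 ω * (connEvent ends a₁ b).indicator 1 ω)))
    (f₆ := fun ω => (avoidAll ends a₂ {a₁}).indicator 1 ω * ((connEvent ends a₂ a₃).indicator 1 ω *
      ((connEvent ends a₂ o).indicator 1 ω * (connEvent ends a₁ b).indicator 1 ω)))
    (f₇ := fun ω => (avoidAll ends a₂ {a₁}).indicator 1 ω * ((connEvent ends a₁ a₃).indicator 1 ω *
      ((connEvent ends a₁ o).indicator 1 ω * (connEvent ends a₂ b).indicator 1 ω)))
    (f₈ := fun ω => (avoidAll ends a₂ {a₁}).indicator 1 ω * ((connEvent ends a₁ a₃).indicator 1 ω *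
      ((connEvent ends a₂ o).indicator 1 ω * (connEvent ends a₂ b).indicator 1 ω)))
    (c₁ := 1) (c₂ := 1) (c₃ := 1) (c₄ := 1) (c₅ := -1) (c₆ := -1) (c₇ := -1) (c₈ := -1)
    (fun ω => by unfold f6 iQ sigma inU iL iH; ring)
  rw [h, expect_ind4, expect_ind4, expect_ind4, expect_ind4, expect_ind4, expect_ind4,
    expect_ind4, expect_ind4]
  unfold EQb3o
  rw [ZOloc.Tp_eq_Q_inter, T_eq_Q_inter]
  simp only [Set.inter_assoc]
  ring

omit [DecidableEq V] in
/-- `E[f₇] = −gap`. -/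
lemma expect_f7 (p : E → R) (ends : E → Sym2 V) (a₁ a₂ b : V) :
    expect p (f7 ends a₁ a₂ b) = -gap p ends a₁ a₂ b := by
  have h := Lambda.expect_comb p (g := f7 ends a₁ a₂ b)
    (f₁ := fun ω => (avoidAll ends a₂ {a₁}).indicator 1 ω * (connEvent ends a₁ b).indicator 1 ω)
    (f₂ := fun ω => (avoidAll ends a₂ {a₁}).indicator 1 ω * (connEvent ends a₂ b).indicator 1 ω)
    (c₁ := 1) (c₂ := -1) (fun ω => by unfold f7 iQ sigma iL iH; ring)
  rw [h, expect_ind2, expect_ind2, gap_eq_Q]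
  ring

omit [DecidableEq V] [LinearOrder R] [IsStrictOrderedRing R] in
/-- `E[f₈] = E_Q[σ_o]`. -/
lemma expect_f8 (p : E → R) (ends : E → Sym2 V) (o a₁ a₂ : V) :
    expect p (f7 ends a₁ a₂ o) = EQo p ends o a₁ a₂ := by
  have h := Lambda.expect_comb p (g := f7 ends a₁ a₂ o)
    (f₁ := fun ω => (avoidAll ends a₂ {a₁}).indicator 1 ω * (connEvent ends a₁ o).indicator 1 ω)
    (f₂ := fun ω => (avoidAll ends a₂ {a₁}).indicator 1 ω * (connEvent ends a₂ o).indicator 1 ω)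
    (c₁ := 1) (c₂ := -1) (fun ω => by unfold f7 iQ sigma iL iH; ring)
  rw [h, expect_ind2, expect_ind2]
  unfold EQo
  ring

omit [DecidableEq V] [LinearOrder R] [IsStrictOrderedRing R] in
/-- `E[f₉] = E_Q[σ₃]`. -/
lemma expect_f9 (p : E → R) (ends : E → Sym2 V) (a₁ a₂ a₃ : V) :
    expect p (f7 ends a₁ a₂ a₃) = EQ3 p ends a₁ a₂ a₃ := by
  have h := Lambda.expect_comb p (g := f7 ends a₁ a₂ a₃)
    (f₁ := fun ω => (avoidAll ends a₂ {a₁}).indicator 1 ω * (connEvent ends a₁ a₃).indicator 1 ω)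
    (f₂ := fun ω => (avoidAll ends a₂ {a₁}).indicator 1 ω * (connEvent ends a₂ a₃).indicator 1 ω)
    (c₁ := 1) (c₂ := -1) (fun ω => by unfold f7 iQ sigma iL iH; ring)
  rw [h, expect_ind2, expect_ind2]
  unfold EQ3
  rw [ZOloc.Tp_eq_Q_inter, T_eq_Q_inter]
  ring

omit [DecidableEq V] [LinearOrder R] [IsStrictOrderedRing R] in
/-- `E[f₁₀] = E_Q[σ₃ 1_{o∈U}]`. -/
lemma expect_f10 (p : E → R) (ends : E → Sym2 V) (o a₁ a₂ a₃ : V) :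
    expect p (f10 ends o a₁ a₂ a₃) = EQ3o p ends o a₁ a₂ a₃ := by
  have h := expect_comb8 p (g := f10 ends o a₁ a₂ a₃)
    (f₁ := fun ω => (avoidAll ends a₂ {a₁}).indicator 1 ω *
      ((connEvent ends a₁ a₃).indicator 1 ω * (connEvent ends a₁ o).indicator 1 ω))
    (f₂ := fun ω => (avoidAll ends a₂ {a₁}).indicator 1 ω *
      ((connEvent ends a₁ a₃).indicator 1 ω * (connEvent ends a₂ o).indicator 1 ω))
    (f₃ := fun ω => (avoidAll ends a₂ {a₁}).indicator 1 ω *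
      ((connEvent ends a₂ a₃).indicator 1 ω * (connEvent ends a₁ o).indicator 1 ω))
    (f₄ := fun ω => (avoidAll ends a₂ {a₁}).indicator 1 ω *
      ((connEvent ends a₂ a₃).indicator 1 ω * (connEvent ends a₂ o).indicator 1 ω))
    (f₅ := fun _ => 0) (f₆ := fun _ => 0) (f₇ := fun _ => 0) (f₈ := fun _ => 0)
    (c₁ := 1) (c₂ := 1) (c₃ := -1) (c₄ := -1) (c₅ := 0) (c₆ := 0) (c₇ := 0) (c₈ := 0)
    (fun ω => by unfold f10 iQ sigma inU iL iH; ring)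
  rw [h, expect_ind3, expect_ind3, expect_ind3, expect_ind3]
  unfold EQ3o
  rw [ZOloc.Tp_eq_Q_inter, T_eq_Q_inter]
  simp only [Set.inter_assoc]
  ring

omit [DecidableEq V] [LinearOrder R] [IsStrictOrderedRing R] in
/-- `E[f₁₁] = P(PD, b ∈ U, o ∈ U)`. -/
lemma expect_f11 (p : E → R) (ends : E → Sym2 V) (o a₁ a₂ a₃ b : V) :
    expect p (f11 ends o a₁ a₂ a₃ b) = PDbo p ends o a₁ a₂ a₃ b := by
  have h := expect_comb8 p (g := f11 ends o a₁ a₂ a₃ b)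
    (f₁ := fun ω => (PDEvent ends a₁ a₂ a₃).indicator 1 ω *
      ((connEvent ends a₁ o).indicator 1 ω * (connEvent ends a₁ b).indicator 1 ω))
    (f₂ := fun ω => (PDEvent ends a₁ a₂ a₃).indicator 1 ω *
      ((connEvent ends a₂ o).indicator 1 ω * (connEvent ends a₁ b).indicator 1 ω))
    (f₃ := fun ω => (PDEvent ends a₁ a₂ a₃).indicator 1 ω *
      ((connEvent ends a₁ o).indicator 1 ω * (connEvent ends a₂ b).indicator 1 ω))
    (f₄ := fun ω => (PDEvent ends a₁ a₂ a₃).indicator 1 ω *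
      ((connEvent ends a₂ o).indicator 1 ω * (connEvent ends a₂ b).indicator 1 ω))
    (f₅ := fun _ => 0) (f₆ := fun _ => 0) (f₇ := fun _ => 0) (f₈ := fun _ => 0)
    (c₁ := 1) (c₂ := 1) (c₃ := 1) (c₄ := 1) (c₅ := 0) (c₆ := 0) (c₇ := 0) (c₈ := 0)
    (fun ω => by unfold f11 iPD inU iL iH; ring)
  rw [h, expect_ind3, expect_ind3, expect_ind3, expect_ind3]
  unfold PDbo
  ring

omit [DecidableEq V] [LinearOrder R] [IsStrictOrderedRing R] in
/-- `E[f₁₂] = P(PD, b ∈ U)`. -/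
lemma expect_f12 (p : E → R) (ends : E → Sym2 V) (a₁ a₂ a₃ b : V) :
    expect p (f12 ends a₁ a₂ a₃ b) = PDb p ends a₁ a₂ a₃ b := by
  have h := Lambda.expect_comb p (g := f12 ends a₁ a₂ a₃ b)
    (f₁ := fun ω => (PDEvent ends a₁ a₂ a₃).indicator 1 ω * (connEvent ends a₁ b).indicator 1 ω)
    (f₂ := fun ω => (PDEvent ends a₁ a₂ a₃).indicator 1 ω * (connEvent ends a₂ b).indicator 1 ω)
    (c₁ := 1) (c₂ := 1) (fun ω => by unfold f12 iPD inU iL iH; ring)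
  rw [h, expect_ind2, expect_ind2]
  unfold PDb
  ring

end Moments

end CovForm

end Summit.Ventures.PercRepro2
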